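import Mathlib
import Literature.Analysis.FluidPDE.ClassicalSolution
import Literature.Analysis.FluidPDE.LerayHopf
import Literature.Analysis.FluidPDE.NSWave0
import Literature.Analysis.FluidPDE.AxisymmetricEuler
import HarnessLib

/-!
# Cruxes `ColumnarCoreExclusion` (stmt-1966) / `MonopoleCoreExclusion` (stmt-1965): the class-free FLAT-CORE statement
# contained in BOTH shadowing stubs (comparison flow = a uniform axial stream)

`--supports stmt-NavierStokesRegularity-1966` (helper file; theorems only, no definitions, no `sorry`).

The [XL] shadowing stubs `stub_columnarShadowing` (line `columnar_comparison_flow`, 1966) and `stub_axisymShadowing`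
(line `axisymmetric_comparison_flow`, 1965) quantify over ALL bounded classical comparison flows `v` of their class on
`[t,T]`.  The simplest flows lying in BOTH classes are the uniform axial streams `v ≡ λ·Q e_z` (zero pressure): they
are columnar along `Q e_z` and, pulled back to the witness frame, axisymmetric (a constant multiple of `e_z` is fixed by
every rotation about the axis).  Instantiating the stubs there isolates a CLASS-FREE, COMPARISON-FREE statement that
both stubs contain (`flatCore_of_columnarShadowing`, `flatAxialCore_of_axisymShadowing`):

  FLAT CORE ⇒ NO LOCAL BLOW-UP WITHIN THE HORIZON.  For every `A > 0` there is `K₀ ≥ 1` such that for `K ≥ K₀`: if a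
  classical Leray–Hopf solution on `[0,T)` (rapidly decaying datum) has at a time `0 < t < T` the core normalisation
  (`‖u(t)‖ ≤ V`, a near-maximum within `L` of `x₀`, `Kν ≤ LV`), the horizon `(T - t)V ≤ KL`, and its slice `u(t)`
  is `A·V/K`-close to a CONSTANT vector (`λ·Q e_z`) on the ball `B(x₀, KL/2)` (resp. `B(x₀, KL)`), then `u` is bounded
  on `[t,T) × B(x₀, 3KL/8)` (resp. `× B(x₀, KL/2)`).

Reading (census of this hand): nothing in this statement constrains `u(t)` outside the ball beyond `‖u(t)‖ ≤ V`, and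
the horizon `KL/V` exceeds the time `KL/(8V)` exterior fluid needs to reach the inner ball; its conclusion fails
only at a genuine Navier–Stokes blow-up inside the inner ball, so it is neither refutable in the tree nor reachable
by a stability mechanism — the precise sense in which both shadowing stubs are "regularity-complete in spirit".
`isClassicalNSSolutionOn_constVec` (a constant velocity with zero pressure solves the unforced system on any time
set) and `isAxisymmetric_const_smul_eZ` are the two kinematic inputs.  Nothing about Navier–Stokes regularity is
claimed; no stub is closed by name.
-/

noncomputable section

open Set Metric MeasureTheory Function Filter Topology
open Literature.Analysis Literature.Analysis.FluidPDE
open scoped ENNReal Laplacian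

namespace Summit.NavierStokesRegularity.NavierStokesRegularity.Theorems

-- the problem directory repeats the summit name (`NavierStokesRegularity/NavierStokesRegularity`)
set_option linter.dupNamespace false

namespace CoreExclusionShadowing

/-! ### §1 Uniform streams -/

/-- **A uniform stream is a classical solution**: the constant velocity field `c` with zero pressure solves the
unforced Navier–Stokes system (any viscosity) on every time set — every term of the momentum equation vanishes and
`div c = 0`. [folklore] -/
theorem isClassicalNSSolutionOn_constVec (S : Set ℝ) (ν : ℝ) (c : EuclideanSpace ℝ (Fin 3)) :
    IsClassicalNSSolutionOn S ν 0 (fun (_ : ℝ) (_ : EuclideanSpace ℝ (Fin 3)) => c)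
      (fun (_ : ℝ) (_ : EuclideanSpace ℝ (Fin 3)) => (0 : ℝ)) where
  smooth_velocity := by
    unfold IsSmoothSpaceTimeOn
    exact contDiffOn_const
  smooth_pressure := by
    unfold IsSmoothSpaceTimeOn
    exact contDiffOn_const
  momentum t _ x := by
    have h1 : timeDerivWithin S (fun (_ : ℝ) (_ : EuclideanSpace ℝ (Fin 3)) => c) t x = 0 := by
      simp [timeDerivWithin]
    have h2 : convect (fun _ : EuclideanSpace ℝ (Fin 3) => c) (fun _ => c) x = 0 := by
      simp [convect]
    have h3 : (Δ (fun _ : EuclideanSpace ℝ (Fin 3) => c)) x = 0 := by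
      exact congrFun (InnerProductSpace.laplacian_const (E := EuclideanSpace ℝ (Fin 3)) (c := c)) x
    have h4 : gradient (fun _ : EuclideanSpace ℝ (Fin 3) => (0 : ℝ)) x = 0 := gradient_fun_const x 0
    rw [h1, h2, h3, h4]
    simp
  divFree t _ := by
    intro x
    simp [VectorCalculus.divergence]

/-- **A constant multiple of the axis vector is an axisymmetric field**: `y ↦ λ e_z` satisfies
`(λ e_z) = R_θ (λ e_z)` for every rotation `R_θ` about the axis. [folklore] -/
theorem isAxisymmetric_const_smul_eZ (c : ℝ) :
    IsAxisymmetric (fun _ : EuclideanSpace ℝ (Fin 3) => c • eZ) := by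
  intro θ x
  ext i
  fin_cases i <;> simp [rotZ, eZ]

/-! ### §2 The flat-core statements contained in the two shadowing stubs -/

/-- **`stub_columnarShadowing` contains FLAT CORE ⇒ NO LOCAL BLOW-UP.**  The registered statement of
`stub_columnarShadowing` (hypothesis, verbatim) implies: for every `A > 0` there is `K₀ ≥ 1` such that for `K ≥ K₀`,
a classical Leray–Hopf solution on `[0,T)` (rapidly decaying datum) whose slice at a time `0 < t < T` has the core
normalisation, the horizon `(T - t)V ≤ KL`, and is `A·V/K`-close to a CONSTANT vector `c` on `B(x₀, KL/2)`, is bounded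
on `[t,T) × B(x₀, 3KL/8)` (the comparison flow `v ≡ c`, `q ≡ 0`, is columnar along every axis). [folklore] -/
theorem flatCore_of_columnarShadowing
    (hS : ∀ A : ℝ, 0 < A → ∃ K₀ : ℝ, 1 ≤ K₀ ∧ ∀ K : ℝ, K₀ ≤ K →
      ∀ (ν T t : ℝ) (u : ℝ → EuclideanSpace ℝ (Fin 3) → EuclideanSpace ℝ (Fin 3))
        (p : ℝ → EuclideanSpace ℝ (Fin 3) → ℝ),
        0 < ν → 0 < T → IsClassicalNSSolutionOn (Ico 0 T) ν 0 u p → IsLerayHopfOn T ν 0 (u 0) u →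
        HasRapidSpatialDecay (u 0) → 0 < t → t < T →
        ∀ (x₀ : EuclideanSpace ℝ (Fin 3)) (L V : ℝ)
          (Q : EuclideanSpace ℝ (Fin 3) ≃ₗᵢ[ℝ] EuclideanSpace ℝ (Fin 3)),
          0 < L → 0 < V → (∀ x, ‖u t x‖ ≤ V) →
          (∃ x₁, dist x₁ x₀ ≤ L ∧ V ≤ 2 * ‖u t x₁‖) → K * ν ≤ L * V → (T - t) * V ≤ K * L →
          ∀ (v : ℝ → EuclideanSpace ℝ (Fin 3) → EuclideanSpace ℝ (Fin 3))
            (q : ℝ → EuclideanSpace ℝ (Fin 3) → ℝ) (Mv : ℝ),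
            IsClassicalNSSolutionOn (Icc t T) ν 0 v q →
            (∀ s ∈ Icc t T, ∀ (x : EuclideanSpace ℝ (Fin 3)) (τ : ℝ), v s (x + τ • Q eZ) = v s x) →
            (∀ s ∈ Icc t T, ∀ x, ‖v s x‖ ≤ Mv) →
            (∀ x ∈ ball x₀ (K * L / 2), ‖u t x - v t x‖ ≤ A * V / K) →
            ∃ M : ℝ, ∀ s ∈ Ico t T, ∀ x ∈ ball x₀ (3 * K * L / 8), ‖u s x‖ ≤ M) :
    ∀ A : ℝ, 0 < A → ∃ K₀ : ℝ, 1 ≤ K₀ ∧ ∀ K : ℝ, K₀ ≤ K →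
      ∀ (ν T t : ℝ) (u : ℝ → EuclideanSpace ℝ (Fin 3) → EuclideanSpace ℝ (Fin 3))
        (p : ℝ → EuclideanSpace ℝ (Fin 3) → ℝ),
        0 < ν → 0 < T → IsClassicalNSSolutionOn (Ico 0 T) ν 0 u p → IsLerayHopfOn T ν 0 (u 0) u →
        HasRapidSpatialDecay (u 0) → 0 < t → t < T →
        ∀ (x₀ : EuclideanSpace ℝ (Fin 3)) (L V : ℝ) (c : EuclideanSpace ℝ (Fin 3)),
          0 < L → 0 < V → (∀ x, ‖u t x‖ ≤ V) →
          (∃ x₁, dist x₁ x₀ ≤ L ∧ V ≤ 2 * ‖u t x₁‖) → K * ν ≤ L * V → (T - t) * V ≤ K * L →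
          (∀ x ∈ ball x₀ (K * L / 2), ‖u t x - c‖ ≤ A * V / K) →
          ∃ M : ℝ, ∀ s ∈ Ico t T, ∀ x ∈ ball x₀ (3 * K * L / 8), ‖u s x‖ ≤ M := by
  intro A hA
  obtain ⟨K₀, hK₀, hK⟩ := hS A hA
  refine ⟨K₀, hK₀, ?_⟩
  intro K hKK ν T t u p hν hT hcl hLH hdec ht htT x₀ L V c hL hV hbd hnear hRe hlate hclose
  exact hK K hKK ν T t u p hν hT hcl hLH hdec ht htT x₀ L V (LinearIsometryEquiv.refl ℝ _) hL hV hbd hnear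
    hRe hlate (fun _ _ => c) (fun _ _ => 0) ‖c‖ (isClassicalNSSolutionOn_constVec (Icc t T) ν c)
    (fun _ _ _ _ => rfl) (fun _ _ _ => le_rfl) hclose

/-- **`stub_axisymShadowing` contains FLAT AXIAL CORE ⇒ NO LOCAL BLOW-UP.**  The registered statement of
`stub_axisymShadowing` (hypothesis, verbatim) implies: for every `A > 0` there is `K₀ ≥ 1` such that for `K ≥ K₀`,
a classical Leray–Hopf solution on `[0,T)` (rapidly decaying datum) whose slice at a time `0 < t < T` has the core
normalisation, the horizon `(T - t)V ≤ KL`, and is `A·V/K`-close on `B(x₀, KL)` to a uniform AXIAL stream `λ·Q e_z`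
(`Q` any frame), is bounded on `[t,T) × B(x₀, KL/2)` (the comparison flow `v ≡ λ Q e_z`, `q ≡ 0`, pulls back to the
constant `λ e_z`, an axisymmetric field). [folklore] -/
theorem flatAxialCore_of_axisymShadowing
    (hS : ∀ A : ℝ, 0 < A → ∃ K₀ : ℝ, 1 ≤ K₀ ∧ ∀ K : ℝ, K₀ ≤ K →
      ∀ (ν T t : ℝ) (u : ℝ → EuclideanSpace ℝ (Fin 3) → EuclideanSpace ℝ (Fin 3))
        (p : ℝ → EuclideanSpace ℝ (Fin 3) → ℝ),
        0 < ν → 0 < T → IsClassicalNSSolutionOn (Ico 0 T) ν 0 u p → IsLerayHopfOn T ν 0 (u 0) u →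
        HasRapidSpatialDecay (u 0) → 0 < t → t < T →
        ∀ (x₀ : EuclideanSpace ℝ (Fin 3)) (L V : ℝ)
          (Q : EuclideanSpace ℝ (Fin 3) ≃ₗᵢ[ℝ] EuclideanSpace ℝ (Fin 3)),
          0 < L → 0 < V → (∀ x, ‖u t x‖ ≤ V) →
          (∃ x₁, dist x₁ x₀ ≤ L ∧ V ≤ 2 * ‖u t x₁‖) → K * ν ≤ L * V → (T - t) * V ≤ K * L →
          ∀ (v : ℝ → EuclideanSpace ℝ (Fin 3) → EuclideanSpace ℝ (Fin 3))
            (q : ℝ → EuclideanSpace ℝ (Fin 3) → ℝ) (Mv : ℝ),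
            IsClassicalNSSolutionOn (Icc t T) ν 0 v q →
            (∀ s ∈ Icc t T, IsAxisymmetric (fun y : EuclideanSpace ℝ (Fin 3) => Q.symm (v s (x₀ + Q y)))) →
            (∀ s ∈ Icc t T, ∀ x, ‖v s x‖ ≤ Mv) →
            (∀ x ∈ ball x₀ (K * L), ‖u t x - v t x‖ ≤ A * V / K) →
            ∃ M : ℝ, ∀ s ∈ Ico t T, ∀ x ∈ ball x₀ (K * L / 2), ‖u s x‖ ≤ M) :
    ∀ A : ℝ, 0 < A → ∃ K₀ : ℝ, 1 ≤ K₀ ∧ ∀ K : ℝ, K₀ ≤ K →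
      ∀ (ν T t : ℝ) (u : ℝ → EuclideanSpace ℝ (Fin 3) → EuclideanSpace ℝ (Fin 3))
        (p : ℝ → EuclideanSpace ℝ (Fin 3) → ℝ),
        0 < ν → 0 < T → IsClassicalNSSolutionOn (Ico 0 T) ν 0 u p → IsLerayHopfOn T ν 0 (u 0) u →
        HasRapidSpatialDecay (u 0) → 0 < t → t < T →
        ∀ (x₀ : EuclideanSpace ℝ (Fin 3)) (L V : ℝ)
          (Q : EuclideanSpace ℝ (Fin 3) ≃ₗᵢ[ℝ] EuclideanSpace ℝ (Fin 3)) (c : ℝ),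
          0 < L → 0 < V → (∀ x, ‖u t x‖ ≤ V) →
          (∃ x₁, dist x₁ x₀ ≤ L ∧ V ≤ 2 * ‖u t x₁‖) → K * ν ≤ L * V → (T - t) * V ≤ K * L →
          (∀ x ∈ ball x₀ (K * L), ‖u t x - c • Q eZ‖ ≤ A * V / K) →
          ∃ M : ℝ, ∀ s ∈ Ico t T, ∀ x ∈ ball x₀ (K * L / 2), ‖u s x‖ ≤ M := by
  intro A hA
  obtain ⟨K₀, hK₀, hK⟩ := hS A hA
  refine ⟨K₀, hK₀, ?_⟩
  intro K hKK ν T t u p hν hT hcl hLH hdec ht htT x₀ L V Q c hL hV hbd hnear hRe hlate hclose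
  have hax : ∀ s ∈ Icc t T, IsAxisymmetric (fun y : EuclideanSpace ℝ (Fin 3) =>
      Q.symm ((fun (_ : ℝ) (_ : EuclideanSpace ℝ (Fin 3)) => c • Q eZ) s (x₀ + Q y))) := by
    intro s _
    have h : (fun y : EuclideanSpace ℝ (Fin 3) =>
        Q.symm ((fun (_ : ℝ) (_ : EuclideanSpace ℝ (Fin 3)) => c • Q eZ) s (x₀ + Q y))) =
        fun _ => c • eZ := by
      funext y
      simp
    rw [h]
    exact isAxisymmetric_const_smul_eZ c
  exact hK K hKK ν T t u p hν hT hcl hLH hdec ht htT x₀ L V Q hL hV hbd hnear hRe hlate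
    (fun _ _ => c • Q eZ) (fun _ _ => 0) ‖c • Q eZ‖ (isClassicalNSSolutionOn_constVec (Icc t T) ν (c • Q eZ))
    hax (fun _ _ _ => le_rfl) hclose

end CoreExclusionShadowing

end Summit.NavierStokesRegularity.NavierStokesRegularity.Theorems

end
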